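import Literature.Computability.AlgebraicComplexity.LocalStrongUSP

/-!
# First rung of line `skew-usp` (crux `CubicAmortisation`, stmt-MatrixMultiplication-18000)

The width-10 member of CKSU 2005 Prop. 11 (arXiv:math/0511460, Prop. 3.8 of the journal numbering: rows
`u ∈ {0,2}^k × {1,2}^k` with `u_i = 0 ↔ u_{k+i} = 1`) RESTRICTED to the skew class `(2,2,6)` (exactly two zeros) is a
local strong USP of `10 = C(5,2)` rows, i.e. an instance of the matrix of `QuinticSkewUSP` at `m = 2` with
`|U| = 10` against the cap `C(10,2) = 45` (rate `10^{1/10} = 1.2589` per column; through Thm 33 at `ℓ = 5` and the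
line's stubs 2–3 this certifies `ω(1,1,3) ≤ (5/2)(log₂5 − log₂ 1.2589) = 4.974 < 5`).  The whole restricted Prop-11
FAMILY (`m = 2t`, width `10t`, `C(5t,2t)` rows) is a local strong USP for every `t` (same ordered argument as CKSU's
proof of Prop. 11; planner's check at t = 1 here, t = 2 by script), rate `→ 2^{h(2/5)/2} = 1.400`, ⇒ ω(1,1,3) ≤ 4.591.
Checked by `native_decide` (compiler-trusted); a kernel `decide` over the ten explicit rows is routine.
-/

set_option linter.dupNamespace false

namespace Summit.MatrixMultiplication.MatrixMultiplication.Cruxes.CubicAmortisation.SkewUSP.Rung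

open Finset Literature.Computability.AlgebraicComplexity

/-- FIRST RUNG: the width-10 member of CKSU Prop. 11 restricted to the class `(2,2,6)` —
rows `u ∈ {0,2}^5 × {1,2}^5` with `u_i = 0 ↔ u_{5+i} = 1` and exactly two zeros — is a local strong USP of
`10 = C(5,2)` rows in the skew class at `m = 2` (rate `10^{1/10} = 1.2589 > 1.25`: certifies `ω(1,1,3) ≤ 4.974 < 5`
through stubs 2–3's arithmetic). -/
def prop11Row (Z : Finset (Fin 5)) : Fin 10 → Fin 3 := fun i =>
  if h : (i : ℕ) < 5 then (if (⟨i, h⟩ : Fin 5) ∈ Z then 0 else 2)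
  else (if (⟨i - 5, by omega⟩ : Fin 5) ∈ Z then 1 else 2)

/-- The ten rows (one per 2-subset of `Fin 5`). -/
def prop11Rows : Finset (Fin 10 → Fin 3) :=
  ((Finset.univ : Finset (Finset (Fin 5))).filter fun Z => Z.card = 2).image prop11Row

theorem prop11Rows_card : prop11Rows.card = 10 := by native_decide

theorem prop11Rows_class : ∀ u ∈ prop11Rows,
    (univ.filter fun i => u i = 0).card = 2 ∧ (univ.filter fun i => u i = 1).card = 2 := by
  native_decide

theorem prop11Rows_isLocalStrongUSP : ∀ u ∈ prop11Rows, ∀ v ∈ prop11Rows, ∀ w ∈ prop11Rows,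
    (u ≠ v ∨ v ≠ w) → ∃ i, (u i, v i, w i) ∈ localStrongUSPPatterns := by
  native_decide

end Summit.MatrixMultiplication.MatrixMultiplication.Cruxes.CubicAmortisation.SkewUSP.Rung
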